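import Literature.Computation.Certificates.Blocks
import Summits.Ventures.GridStability.Lyapunov.NE39SPSlabSSum

/-!
# GridStability/Lyapunov/NE39SPSlabSId5 — «G2.b-NE39SP-SLAB-CLQ» (#53): identity `AqS = Σ embedded blocks`, rows 76…94 (kernel)

Cell `gridfusion` (LADDER-GRIDFUSION G2, SP–Lur'e lane), row candidate «G2.b-NE39SP-SLAB-CLQ» (#53; lead RULING (R-a) AMENDED
2026-08-27T08:21:56Z «sos-4: FILE PSD»): the n = 58 structure-preserving NE39 slab row by the CLIQUE route. OBJECT `NE39SP.relLurie D`
(Models/NE39SPLurie.lean: 58 states `Fin 48 ⊕ Fin 10`, 56 lines, reference bus 39) with D = `1/10` at all 49 nodes — SYNTHETIC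
uniform damping (declared; MODEL-VALIDITY SP–Lur'e block). CERTIFICATE (seat gridfusion-sos-4 g4, kit j273316, file
`cert/sos-4/j273316/lchord-R6-NE39SP-D1o10-nbr-csJ-epsP-dm1e-05.json` sha16 033ca4741cd2bb31): a Lur'e–Postnikov slab certificate (slab `u = 1/4`, sectors `a = 5/8`,
`b = 1`, `η = 1/1000`, Popov on all 56 lines) whose Lyapunov matrix `P` is STRUCTURED (nonzero 2-node blocks only on network
lines, pattern «nbr») so that `−𝓛` (114 × 114) is the SUM of 64 clique-embedded blocks ≤ 19 × 19 and `P − ε·1` (58 × 58) the sum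
of 41 blocks ≤ 4 × 4 [cite: ZhengFantuzziPapachristodoulou2018, §3.2 Theorem 2 (Agler)], every block carrying an integer Gram
certificate of ≤ 35 digits (solver: Clarabel on a per-index Jacobi-scaled LMI, objective = maximise ε_P under P ⪯ I with the clique structure fixed; dyadic rounding,
Peyrl–Parrilo projection onto the clique identities, exact re-verification — all VALIDATED-column provenance). DATA module:
`Summits.Ventures.GridStability.Lyapunov.NE39SPSlabSData` (`AqS`, `PSq`, `epsSQ`, `tauSQ`, `lamSQ`; this lineage's own data file). Index convention
(global LMI index `Fin 114`): `i < 48` ↦ state `inl i` (relative angle), `48 + j` ↦ state `inr j` (machine speed), `58 + e` ↦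
line/channel `e` — i.e. model-2's `e2 : (Fin 48 ⊕ Fin 10) ⊕ Fin 56 ≃ Fin 114`. THREE COLUMNS: these files are exact DATA +
kernel-decided PSD facts about the literal matrices `AqS` / `PSq − ε·1`; that `AqS` IS `−slabMatrix (relLurie D) P η λ τ a b` is the
Bench/Id step (model-2); nothing here says the New England system is stable; the region these data will certify is an inner
estimate for a structure-preserving NE39 VARIANT with DECLARED SYNTHETIC damping. Generator `sos4/gen_slabS_lean.py` (HOME/cert/sos-4/).

This file: ONE `decide +kernel` — the rows 76…94 of the entrywise identity between the literal `AqS` and the explicit clique sum `sumL`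
(measured ≈ 70 s of kernel per 19-row shard at N = 114, 64 blocks ≤ 19: the cost is the 64 membership scans per entry).
-/

set_option linter.style.longLine false
set_option maxRecDepth 100000

open Matrix Literature.Computation.Certificates

namespace Summit.Ventures.GridStability.Lyapunov.NE39SPSlabS

set_option maxHeartbeats 1600000 in
/-- identity `AqS = sumL`, rows 76…94 (kernel). -/
theorem aq_rows_4 : ∀ i : Fin 114, 19 * (4 : ℕ) ≤ i.val → i.val < 19 * ((4 : ℕ) + 1) → ∀ j, sumL i j = AqS i j := by
  decide +kernel

end Summit.Ventures.GridStability.Lyapunov.NE39SPSlabS
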